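import Summits.HodgeConjecture.HodgeConjecture.Theorems.NikulinTwinTransportTwinSimilitudeAlgebraicHKDefs
import Summits.HodgeConjecture.HodgeConjecture.Theses.EndoscopicMiddleDegree
import Literature.AlgebraicGeometry.Hyperkaehler.SymplecticInvolutionK3Square
import Literature.AlgebraicGeometry.Hyperkaehler.MarkmanRationalHodgeIsometries
import Literature.AlgebraicGeometry.Hyperkaehler.K3HilbertSquareIncidence
import Literature.AlgebraicGeometry.Surfaces.K3NikulinInvolution
import Summits.HodgeConjecture.HodgeConjecture.Theorems.NikulinTwinTransportTwinSimilitudeAlgebraicHKMarkedTransport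
import Summits.HodgeConjecture.HodgeConjecture.Theorems.NikulinTwinTransportTwinSimilitudeAlgebraicHKPerpTr
import Summits.HodgeConjecture.HodgeConjecture.Theorems.NikulinTwinTransportTwinSimilitudeAlgebraicHKLatticeTransport
import Summits.HodgeConjecture.HodgeConjecture.Theorems.NikulinTwinTransportTwinSimilitudeAlgebraicStubCorrCalculus
import Summits.HodgeConjecture.HodgeConjecture.Theorems.NikulinTwinTransportTwinSimilitudeAlgebraicStubMarkingPeriodPt
import Literature.AlgebraicGeometry.Surfaces.K3Marking
import Literature.AlgebraicGeometry.HodgeTheory.HodgeTypeExteriorProduct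
import Literature.AlgebraicGeometry.HodgeTheory.ChernCharacterBetti
import HarnessLib

/-!
# Route NikulinTwinTransport · crux X = `TwinSimilitudeAlgebraic` (stmt-HodgeConjecture-13674) —
# line `hyperkaehler-nikulin-anchors`: THE HEART, assembled (`stub_hkTwinClassAssembly`)

The registered heart of the checked skeleton
`Cruxes/TwinSimilitudeAlgebraic/Lines/hyperkaehler_nikulin_anchors.lean` (reshape r2):

  `stub_hkTwinClassAssembly : HKLatticeWitt → HKNikulinTwinClass` (spelled out, r3),

i.e. **every projective K3 surface `S` in the HK-Nikulin sector has a PARTIAL ALGEBRAIC TWIN CLASS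
into some projective K3 surface `F`** (`IsPartialTwinClass`), granted the lattice datum (sub-stub A),
the correspondence calculus (sub-stub B, landed), the period clauses (sub-stub C, landed), the facts
`HodgeK3Facts` (K3 markings exist + the four hyperkähler Literature facts F1–F4), the moving-lemma
item `CupProductAlgebraic` and the two `(1,1)` route items.  PROOF (the hyperkähler Nikulin anchor):
mark `S` by the sector (`η, p₁, x`, `J : T_x ↪ N_ℚ`); the period clauses hold for this marking
(`MarkingPeriodPt`); `HKLatticeWitt` gives a rational isometry `g` of `(Λ_{K3} ⊕ ⟨−2⟩)_ℚ` with
`z := g_ℂ(x, 0)` an `I`-invariant projective period; F1 realises a BBF-marked projective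
`K3^{[2]}`-type `X` with a symplectic involution at the period `z`; F2 gives its fixed K3
`ν : F ↪ X` with `ν^*` doubling the BBF form on `T(X)` and `ν^*(T(X)) = T(F)`; F4 gives the Hilbert
square `H` of `S`, BBF-marked with period `(x, 0)`, and the algebraic incidence class `θ` acting as
`a ↦ (η a, 0)` in the markings; the marked transport `f = φ⁻¹ ∘ g_ℂ ∘ φ_H : H²(H) → H²(X)` is a
bijective rational type-preserving marked isometry (`exists_markedTransport`), hence ALGEBRAIC by
Markman (F3): `f = [Z]_*`; the correspondence calculus composes `ν^* ∘ [Z]_* ∘ [θ]_*` into ONE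
algebraic class `Γ` on `F ⊗ S`; finally the five clauses of `IsPartialTwinClass` are linear algebra
in the markings (`perp_iff_tr` converts the carriers' `Perp` into the markings' `Tr` on the two K3
surfaces, using the `(1,1)` route items).

No definitions, no new named facts.  Prover seat prover-line-stmt-HodgeConjecture-13674-c1-0 (lead).

## References

* [CamereEtAl2026] C. Camere, A. Garbagnati, G. Kapustka, M. Kapustka, arXiv:2607.00130, §2.3,
  Lemma 5.5, Thm. 5.12.
* [CamereEtAl2023] the same, Algebra Number Theory 18 (2024), Prop. 3.16 and Lemma 4.3.
* [Mongardi2011] G. Mongardi, Cent. Eur. J. Math. 10 (2012), Thm. 4.1, Thm. 5.2, Cor. 5.3.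
* [Markman2024] E. Markman, Compos. Math. 160 (2024), Thm. 1.1.
* [Beauville1983] A. Beauville, J. Differential Geom. 18 (1983), §6 Prop. 6, §9.
* [Huybrechts2016K3] D. Huybrechts, Lectures on K3 Surfaces, CUP 2016, Ch. 3 Lemma 3.1.
-/

noncomputable section

set_option linter.dupNamespace false

open CategoryTheory MonoidalCategory
open scoped Matrix
open Literature.AlgebraicGeometry.Motives Literature.AlgebraicGeometry.HodgeTheory
open Literature.AlgebraicGeometry.Surfaces Literature.AlgebraicGeometry.Hyperkaehler
open Literature.AlgebraicTopology.SingularHomology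
open Summit.HodgeConjecture.HodgeConjecture.Theses.NikulinTwinTransport

namespace Summit.HodgeConjecture.HodgeConjecture.Theorems.NikulinTwinTransport

/-- `Tr₂[w ; z]` (verbatim the notation of the Literature facts). Local notation only. -/
local notation3 (prettyPrint := false) "Tr₂[" w " ; " z "]" =>
  (∀ v : K3HilbertIndex → ℚ, k3HilbertForm 2 (fun i => ((v i : ℚ) : ℂ)) z = 0 →
    k3HilbertForm 2 (fun i => ((v i : ℚ) : ℂ)) w = 0)

/-- `Tr[w ; x]` (verbatim the notation of the Literature facts). Local notation only. -/
local notation3 (prettyPrint := false) "Tr[" w " ; " x "]" =>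
  (∀ v : K3Index → ℚ, k3Form (fun i => ((v i : ℚ) : ℂ)) x = 0 → k3Form (fun i => ((v i : ℚ) : ℂ)) w = 0)

/-- `Gen[S, p]`: `p` is an integral generator of `H⁴(S(ℂ); ℂ)` (verbatim the route notation).
Local notation only. -/
local notation3 (prettyPrint := false) "Gen[" S ", " p "]" =>
  (IsIntegralClass p ∧ ∀ q : complexBetti S (2 * 2), IsIntegralClass q → ∃ n : ℤ, q = n • p)

/-- `Perp[S ; x]` (verbatim the notation of `IsPartialTwinClass`). Local notation only. -/
local notation3 (prettyPrint := false) "Perp[" S " ; " x "]" =>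
  ∀ d ∈ algebraicClasses S 1, cupProduct (rfl : 2 * 1 + 2 * 1 = 2 * 2) x d = 0

/-! ### Small bookkeeping lemmas -/

/-- Two integral generators of `H⁴` of the same surface differ by a sign `n`, `n² = 1`. [folklore] -/
theorem exists_sign_of_generators {S : SchemeOver ℂ} {p p₁ : complexBetti S (2 * 2)} (hp0 : p ≠ 0)
    (hp : IsIntegralClass p) (hpgen : ∀ q : complexBetti S (2 * 2), IsIntegralClass q → ∃ n : ℤ, q = n • p)
    (hp₁ : IsIntegralClass p₁)
    (hp₁gen : ∀ q : complexBetti S (2 * 2), IsIntegralClass q → ∃ n : ℤ, q = n • p₁) :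
    ∃ n : ℤ, p₁ = (n : ℂ) • p ∧ (n : ℂ) * n = 1 := by
  obtain ⟨n, hn⟩ := hpgen p₁ hp₁
  obtain ⟨m, hm⟩ := hp₁gen p hp
  refine ⟨n, by rw [hn, Int.cast_smul_eq_zsmul ℂ], ?_⟩
  have hmn : ((m * n : ℤ) : ℂ) = 1 := by
    have h : ((m * n : ℤ) : ℂ) • p = (1 : ℂ) • p := by
      rw [one_smul, Int.cast_smul_eq_zsmul ℂ, mul_smul, ← hn, ← hm]
    exact smul_left_injective ℂ hp0 h
  rcases Int.eq_one_or_neg_one_of_mul_eq_one' (show m * n = 1 by exact_mod_cast hmn) with ⟨-, rfl⟩ | ⟨-, rfl⟩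
  · simp
  · simp

/-- `Sum.elim` of a cast rational vector and `0` is a cast rational vector of `ℚ²³`. [folklore] -/
theorem sum_elim_ratCast_zero (v : K3Index → ℚ) :
    Sum.elim (fun i => ((v i : ℚ) : ℂ)) (0 : Unit → ℂ) = fun i => ((Sum.elim v 0 i : ℚ) : ℂ) := by
  funext i; rcases i with i | u <;> simp

/-- Scalars pass through `(w, 0)`: `t • (x, 0) = (t • x, 0)`. [folklore] -/
theorem smul_sum_elim_zero (t : ℂ) (x : K3Index → ℂ) :
    t • Sum.elim x (0 : Unit → ℂ) = Sum.elim (t • x) 0 := by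
  funext i; rcases i with i | u <;> simp

/-! ### The heart -/

/-- **THE HEART OF LINE `hyperkaehler-nikulin-anchors`, ASSEMBLED** (module docstring): the lattice
datum, the correspondence calculus and the period clauses imply `HKNikulinTwinClass` — every
projective K3 surface in the HK-Nikulin sector has a partial algebraic twin class, granted the facts
F1–F4 + K3 markings, `CupProductAlgebraic` and the two `(1,1)` route items.
[cite: CamereEtAl2026, §2.3, Lemma 5.5 and Thm. 5.12] [cite: Markman2024, Thm. 1.1]
[cite: Beauville1983, §6 Prop. 6 and §9 Rem. 1] [cite: Mongardi2011, Thm. 4.1 and Cor. 5.3] -/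
theorem stub_hkTwinClassAssembly :
    (∀ (x : K3Index → ℂ), k3Form x x = 0 → 0 < (k3Form (star x) x).re →
      (∃ u : K3Index → ℤ, k3Form (fun i => (u i : ℂ)) x = 0 ∧ 0 < ∑ i, ∑ j, u i * k3Gram i j * u j) →
      ∀ J : (K3Index → ℚ) →ₗ[ℚ] (HostIndex → ℚ),
        (∀ v ∈ trRat x, ∀ w ∈ trRat x, hostFormRat (J v) (J w) = k3FormRat v w) →
        (∀ v ∈ trRat x, J v = 0 → v = 0) →
        ∃ (g : (K3HilbertIndex → ℚ) ≃ₗ[ℚ] (K3HilbertIndex → ℚ)) (z : K3HilbertIndex → ℂ),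
          (∀ v w : K3HilbertIndex → ℚ,
              k3HilbertForm 2 (fun i => ((g v i : ℚ) : ℂ)) (fun i => ((g w i : ℚ) : ℂ)) =
                k3HilbertForm 2 (fun i => ((v i : ℚ) : ℂ)) (fun i => ((w i : ℚ) : ℂ))) ∧
          (LinearMap.toMatrix' g.toLinearMap).map (fun q : ℚ => (q : ℂ)) *ᵥ Sum.elim x 0 = z ∧
          (∀ i, z (Sum.map k3BlockSwap id i) = z i) ∧
          k3HilbertForm 2 z z = 0 ∧ 0 < (k3HilbertForm 2 (star z) z).re ∧
          ∃ u : K3HilbertIndex → ℤ, k3HilbertForm 2 (fun i => (u i : ℂ)) z = 0 ∧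
            0 < ∑ i, ∑ j, u i * k3HilbertGram 2 i j * u j) →
    (Huybrechts_K3_marking_exists ∧ CamereEtAl2026_symplecticInvolution_periodSurjective ∧
        CamereEtAl2023_fixedK3_restriction ∧ Markman2024_rationalHodgeIsometry_algebraic_marked ∧
        Beauville1983_hilbertSquare_markedIncidence) →
    Summit.HodgeConjecture.HodgeConjecture.Theses.EndoscopicMiddleDegree.CupProductAlgebraic →
    LefschetzOneOneK3 → AlgebraicClassesOneOneK3 →
    ∀ (μ : OrientationFamily), μ.HasPoincareDuality →
      ∀ (S : SchemeOver ℂ) (hS : IsK3Surface S) (p : complexBetti S (2 * 2)), Gen[S, p] →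
        InHKNikulinSector S →
        ∃ (Sg : SchemeOver ℂ) (hSg : IsK3Surface Sg) (pg : complexBetti Sg (2 * 2)), Gen[Sg, pg] ∧
          ∃ γ ∈ algebraicClasses (MonoidalCategoryStruct.tensorObj Sg S) 2,
            IsPartialTwinClass μ S Sg hS hSg p pg γ := by
  intro hW h₀ hCup hL hN μ hμ S hS p hp hsec
  obtain ⟨hM, hF1, hF2, hF3, hF4⟩ := h₀
  have hSsp : IsSmoothProjective 2 S := IsK3Surface.isSmoothProjective hS
  -- the sector marking of `S`
  obtain ⟨η, p₁, x, hmk, J, hJiso, hJinj⟩ := hsec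
  have hηint := hmk.2.2.1
  have hcupS := hmk.2.2.2.1
  have h20S := hmk.2.2.2.2.1
  have hlineS := hmk.2.2.2.2.2
  have hp0 : p ≠ 0 := generator_ne_zero hS hp.2
  have hp₁0 : p₁ ≠ 0 := generator_ne_zero hS hmk.2.1
  obtain ⟨sgn, hp₁, hsgn⟩ := exists_sign_of_generators hp0 hp.1 hp.2 hmk.1 hmk.2.1
  -- the period clauses for this marking (sub-stub C, landed)
  obtain ⟨hx0, hxpos, hu⟩ := stub_markingPeriodPt hM S hS η p₁ x hmk
  have hx : x ≠ 0 := by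
    intro h
    rw [h] at hxpos
    simp [k3Form] at hxpos
  -- the lattice datum (sub-stub A)
  obtain ⟨g, z, hgiso, hzdef, hzinv, hz0, hzpos, huz⟩ := hW x hx0 hxpos hu J hJiso hJinj
  set M : Matrix K3HilbertIndex K3HilbertIndex ℚ := LinearMap.toMatrix' g.toLinearMap with hMdef
  set M' : Matrix K3HilbertIndex K3HilbertIndex ℚ := LinearMap.toMatrix' g.symm.toLinearMap with hM'def
  have hMM' : M * M' = 1 := by
    rw [hMdef, hM'def, ← LinearMap.toMatrix'_comp, ← LinearEquiv.coe_trans, LinearEquiv.symm_trans_self,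
      LinearEquiv.refl_toLinearMap, LinearMap.toMatrix'_id]
  have hM'M : M' * M = 1 := by
    rw [hMdef, hM'def, ← LinearMap.toMatrix'_comp, ← LinearEquiv.coe_trans, LinearEquiv.self_trans_symm,
      LinearEquiv.refl_toLinearMap, LinearMap.toMatrix'_id]
  set MC : Matrix K3HilbertIndex K3HilbertIndex ℂ := M.map (fun q : ℚ => (q : ℂ)) with hMC
  set M'C : Matrix K3HilbertIndex K3HilbertIndex ℂ := M'.map (fun q : ℚ => (q : ℂ)) with hM'C
  have hMCM'C : MC * M'C = 1 := ratCast_map_mul_eq_one hMM'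
  have hM'CMC : M'C * MC = 1 := ratCast_map_mul_eq_one hM'M
  have hisoC : ∀ a b : K3HilbertIndex → ℂ, k3HilbertForm 2 (MC *ᵥ a) (MC *ᵥ b) = k3HilbertForm 2 a b := by
    refine k3HilbertForm_ratMatrix_of_basis 2 M fun v w => ?_
    rw [ratCast_map_mulVec_ratCast, ratCast_map_mulVec_ratCast, hMdef, LinearMap.toMatrix'_mulVec,
      LinearMap.toMatrix'_mulVec]
    exact hgiso v w
  have hisoC' : ∀ a b : K3HilbertIndex → ℂ, k3HilbertForm 2 (M'C *ᵥ a) (M'C *ᵥ b) = k3HilbertForm 2 a b := by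
    intro a b
    rw [← hisoC (M'C *ᵥ a) (M'C *ᵥ b), Matrix.mulVec_mulVec, Matrix.mulVec_mulVec, hMCM'C,
      Matrix.one_mulVec, Matrix.one_mulVec]
  have hzM : MC *ᵥ Sum.elim x 0 = z := hzdef
  have hzM' : M'C *ᵥ z = Sum.elim x 0 := by
    rw [← hzM, Matrix.mulVec_mulVec, hM'CMC, Matrix.one_mulVec]
  -- F1: the involution fourfold at the period `z`
  obtain ⟨X, ι, φ, P, hX, hK, hιι, hιne, hιs, hmX, -⟩ := hF1 z hzinv hz0 hzpos huz
  -- F2: its fixed K3 surface and the restriction map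
  obtain ⟨F, ν, hF, -, -, hF2'⟩ := hF2 X hX hK ι hιι hιne hιs φ P z hmX
  have hFsp : IsSmoothProjective 2 F := IsK3Surface.isSmoothProjective hF
  obtain ⟨ηF, pF, xF, hpF0, hmF, hperF⟩ := hM F hF
  obtain ⟨hdbl, hinto, honto⟩ := hF2' ηF pF xF hmF
  have hxF : xF ≠ 0 := by
    intro h
    have h2 := hperF.2.1
    rw [h] at h2
    simp [k3Form] at h2
  -- F4: the Hilbert square of `S` and the incidence class
  obtain ⟨H, hH, -, φH, PH, -, hKH, hmH, θ, hθalg, hθ⟩ := hF4 μ hμ S hS η p₁ x hmk hx0 hxpos hu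
  have hHint := hmH.2.1
  -- the marked transport `f = φ⁻¹ ∘ g_ℂ ∘ φ_H`, algebraic by Markman (F3)
  obtain ⟨f, hφf, hbij, hrat, htyp, hfiso⟩ := exists_markedTransport hH hX φH PH (Sum.elim x 0) φ P z
    hmH hmX M M' hMM' hM'M hisoC one_ne_zero (by rw [one_smul]; exact hzM)
  obtain ⟨Z, hZalg, hfZ⟩ := hF3 μ hμ H X hH hX hKH hK φH PH (Sum.elim x 0) φ P z hmH hmX f hbij hrat
    htyp hfiso
  -- the correspondence calculus (sub-stub B, landed): graph of `ν`, then two compositions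
  obtain ⟨γν, hγν, hγνact⟩ := stub_corrCalculus.2 μ hμ F X 2 4 (2 * 1) hFsp hX ν
  obtain ⟨ZΘ, hZΘ, hZΘact⟩ :=
    stub_corrCalculus.1 hCup μ hμ X H S 4 4 2 (2 * 1) hX hH hSsp Z hZalg θ hθalg
  obtain ⟨Γ, hΓ, hΓact⟩ :=
    stub_corrCalculus.1 hCup μ hμ F X S 2 4 2 (2 * 1) hFsp hX hSsp γν hγν ZΘ hZΘ
  -- the action of `θ`, of `Z` and of `Γ` in the degree-`2·1` reading
  have hθ' : ∀ y : complexBetti S (2 * 1),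
      corrAction μ hH hSsp (rfl : 2 * 1 + 2 * 2 = 2 * 1 + 2 * 2) θ y = φH.symm (Sum.elim (η y) 0) := by
    intro y
    have h := hθ y
    rw [← h, LinearEquiv.symm_apply_apply]
  have hZ' : ∀ c : complexBetti H (2 * 1),
      corrAction μ hX hH (rfl : 2 * 1 + 2 * 4 = 2 * 1 + 2 * 4) Z c = f c := fun c => (hfZ c).symm
  have hΦ : ∀ y : complexBetti S (2 * 1),
      corrAction μ hFsp hSsp (rfl : 2 * 1 + 2 * 2 = 2 * 1 + 2 * 2) Γ y =
        complexBetti.map ν (2 * 1) (f (φH.symm (Sum.elim (η y) 0))) := by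
    intro y
    rw [hΓact, hZΘact, hθ', hZ', hγνact]
  -- coordinates of `a y := f (θ_* y)`: `φ (a y) = g_ℂ (η y, 0)`
  have hcoord : ∀ w : K3Index → ℂ, φ (f (φH.symm (Sum.elim w 0))) = MC *ᵥ Sum.elim w 0 := fun w => by
    rw [hφf, LinearEquiv.apply_symm_apply]
  -- transport of the transcendental condition from `S` to `X`
  have hTa : ∀ w : K3Index → ℂ, Tr[w ; x] → Tr₂[φ (f (φH.symm (Sum.elim w 0))) ; z] := by
    intro w hw
    rw [hcoord, ← hzM]
    exact tr₂_mulVec_of_tr₂ M M' hMM' hisoC ((tr₂_elim_iff_tr w x).2 hw)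
  -- the generator of `H⁴(F)` with the right sign
  refine ⟨F, hF, (sgn : ℂ) • pF, ⟨?_, ?_⟩, Γ, hΓ, ?_⟩
  · exact hmF.1.zsmul sgn
  · intro q hq
    obtain ⟨k, hk⟩ := hmF.2.1 q hq
    refine ⟨k * sgn, ?_⟩
    rw [hk, ← Int.cast_smul_eq_zsmul ℂ, ← Int.cast_smul_eq_zsmul ℂ, smul_smul, Int.cast_mul, mul_assoc,
      hsgn]
    ring_nf
  unfold IsPartialTwinClass
  refine ⟨?_, ?_, ?_, ?_, ?_⟩
  · -- (1) rationality
    intro y hy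
    obtain ⟨v, hv⟩ := (isRationalClass_iff_of_marking hS η hηint y).1 hy
    change IsRationalClass (corrAction μ hFsp hSsp (rfl : 2 * 1 + 2 * 2 = 2 * 1 + 2 * 2) Γ y)
    rw [hΦ, hv, sum_elim_ratCast_zero]
    exact (hrat _ (isRationalClass_latticeMarking_symm_ratCast φH hHint _)).pullback _
  · -- (2) Hodge types
    intro i j y hy
    change IsOfHodgeType 2 F (2 * 1) i j (corrAction μ hFsp hSsp (rfl : 2 * 1 + 2 * 2 = 2 * 1 + 2 * 2) Γ y)
    rw [hΦ]
    refine (htyp i j _ ?_).map_of_isSmoothProjective hFsp hX ν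
    -- `θ_* y = φ_H⁻¹ (η y, 0)` has the type of `y`, read in the markings
    have h20H := hmH.2.2.2.1.1
    have h11H := hmH.2.2.2.2.1
    obtain ⟨AH, -⟩ := id h20H
    have hσ0 : η.symm x ≠ 0 := fun h => hx (by simpa using congrArg η h)
    obtain ⟨-, -, h11S⟩ := Huybrechts_K3_hodgeTypes_H2_holds S hS (η.symm x) h20S hσ0
    by_cases hij : i + j = 2
    · rcases Nat.lt_or_ge i 3 with hi | hi
      · interval_cases i
        · obtain rfl : j = 2 := by omega
          have hcy : IsOfHodgeType 2 S (2 * 1) 2 0 (conjClass (ComplexPoints S) (2 * 1) y) :=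
            hy.conjClass hSsp
          obtain ⟨t, ht⟩ := hlineS _ hcy
          have hy' : y = starRingEnd ℂ t • η.symm (star x) := by
            rw [← conjClass_conjClass y, ht, conjClass_smul, conjClass_marking_symm η hηint]
          rw [hy', map_smul, η.apply_symm_apply, ← smul_sum_elim_zero, map_smul, ← star_sum_elim_zero,
            ← conjClass_latticeMarking_symm φH hHint]
          exact (h20H.conjClass hH).smul _
        · obtain rfl : j = 1 := by omega
          obtain ⟨hyσ, hyσbar⟩ := (h11S y).1 hy
          rw [hcupS, η.apply_symm_apply, smul_eq_zero] at hyσ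
          rw [conjClass_marking_symm η hηint, hcupS, η.apply_symm_apply, smul_eq_zero] at hyσbar
          refine (h11H _).2 ⟨?_, ?_⟩
          · rw [φH.apply_symm_apply, k3HilbertForm_elim_zero_elim]
            exact hyσ.resolve_right hp₁0
          · rw [φH.apply_symm_apply, star_sum_elim_zero, k3HilbertForm_elim_zero_elim]
            exact hyσbar.resolve_right hp₁0
        · obtain rfl : j = 0 := by omega
          obtain ⟨t, rfl⟩ := hlineS y hy
          rw [map_smul, η.apply_symm_apply, ← smul_sum_elim_zero, map_smul]
          exact h20H.smul _
      · exfalso; omega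
    · have hy0 : y = 0 := isOfHodgeType_eq_zero_of_add_ne hy hij
      rw [hy0, map_zero]
      have : Sum.elim (0 : K3Index → ℂ) (0 : Unit → ℂ) = 0 := by funext i; rcases i with i | u <;> rfl
      rw [this, map_zero]
      exact IsOfHodgeType.zero AH 2 i j
  · -- (3) `Φ(T(S)) ⊆ T(F)`
    intro y hPy
    change Perp[F ; corrAction μ hFsp hSsp (rfl : 2 * 1 + 2 * 2 = 2 * 1 + 2 * 2) Γ y]
    rw [hΦ]
    have hTy : Tr[η y ; x] := (perp_iff_tr hS η p₁ x hL hN hmk hx hp₁0 y).1 hPy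
    exact (perp_iff_tr hF ηF pF xF hL hN hmF hxF hpF0 _).2 (hinto _ (hTa _ hTy))
  · -- (4) `T(F) ⊆ Φ(T(S))`
    intro y' hPy'
    have hTy' : Tr[ηF y' ; xF] := (perp_iff_tr hF ηF pF xF hL hN hmF hxF hpF0 y').1 hPy'
    obtain ⟨a₀, ha₀T, ha₀⟩ := honto y' hTy'
    -- pull `φ a₀` back along `g`: `w₀ := g⁻¹ (φ a₀) ∈ T((x, 0))`, so its `δ`-component vanishes
    have hw₀T : Tr₂[M'C *ᵥ φ a₀ ; Sum.elim x 0] := by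
      rw [← hzM']
      exact tr₂_mulVec_of_tr₂ M' M hM'M hisoC' ha₀T
    have hδ : (M'C *ᵥ φ a₀) (Sum.inr ()) = 0 := apply_inr_eq_zero_of_tr₂_elim hw₀T
    set w₁ : K3Index → ℂ := fun i => (M'C *ᵥ φ a₀) (Sum.inl i) with hw₁
    have hw₀ : M'C *ᵥ φ a₀ = Sum.elim w₁ 0 := eq_sum_elim_of_apply_inr_eq_zero hδ
    have hw₁T : Tr[w₁ ; x] := (tr₂_elim_iff_tr w₁ x).1 (by rw [← hw₀]; exact hw₀T)
    refine ⟨η.symm w₁, (perp_iff_tr hS η p₁ x hL hN hmk hx hp₁0 _).2 (by rwa [η.apply_symm_apply]), ?_⟩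
    change corrAction μ hFsp hSsp (rfl : 2 * 1 + 2 * 2 = 2 * 1 + 2 * 2) Γ (η.symm w₁) = y'
    rw [hΦ, η.apply_symm_apply, ← ha₀]
    congr 1
    apply φ.injective
    rw [hcoord, ← hw₀, Matrix.mulVec_mulVec, hMCM'C, Matrix.one_mulVec]
  · -- (5) doubling on `T(S)`
    intro y₁ hP₁ y₂ hP₂ a ha
    have hT₁ : Tr[η y₁ ; x] := (perp_iff_tr hS η p₁ x hL hN hmk hx hp₁0 y₁).1 hP₁
    have hT₂ : Tr[η y₂ ; x] := (perp_iff_tr hS η p₁ x hL hN hmk hx hp₁0 y₂).1 hP₂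
    change cupProduct (rfl : 2 * 1 + 2 * 1 = 2 * 2)
        (corrAction μ hFsp hSsp (rfl : 2 * 1 + 2 * 2 = 2 * 1 + 2 * 2) Γ y₁)
        (corrAction μ hFsp hSsp (rfl : 2 * 1 + 2 * 2 = 2 * 1 + 2 * 2) Γ y₂) = ((2 : ℂ) * a) • ((sgn : ℂ) • pF)
    rw [hΦ, hΦ, hdbl _ _ (hTa _ hT₁) (hTa _ hT₂), hcoord, hcoord, hisoC, k3HilbertForm_elim_zero_elim,
      smul_smul]
    -- `y₁ ∪ y₂ = (ηy₁.ηy₂) p₁ = a p` pins `(ηy₁.ηy₂) = a · sgn`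
    have hq : k3Form (η y₁) (η y₂) = a * sgn := by
      have h : (k3Form (η y₁) (η y₂) * sgn) • p = a • p := by
        rw [← ha, hcupS, hp₁, smul_smul]
      have h' := smul_left_injective ℂ hp0 h
      calc k3Form (η y₁) (η y₂) = k3Form (η y₁) (η y₂) * ((sgn : ℂ) * sgn) := by rw [hsgn]; ring
        _ = k3Form (η y₁) (η y₂) * sgn * sgn := by ring
        _ = a * sgn := by rw [h']
    rw [hq]
    congr 1
    ring

end Summit.HodgeConjecture.HodgeConjecture.Theorems.NikulinTwinTransport

end
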